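import Literature.RepresentationTheory.Paul1998.DetCoverPrincipalSection
import Literature.RepresentationTheory.Paul1998.MetaplecticCocycleSectionParityW
import Literature.NumberTheory.Weil1964.ArchMetaplecticUnitarySplitting
import Literature.NumberTheory.Weil1964.ArchMetaplecticSchurContinuity
import HarnessLib

/-!
# Paul's record (1.2.1)–(1.2.2) at EVERY real rank, hypothesis-free: the principal `det^{1/2}` sections are
# strongly continuous at `1` (the last input of `DetCoverPrincipalSection`)

Topic `RepresentationTheory/Paul1998`; namespace `Literature.RepresentationTheory.Paul1998.MetaplecticSplitting`.
KERNEL ONLY: theorems; no definition, no record, no hypothesis beyond those displayed, no `sorry`.  Sequel of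
`DetCoverPrincipalSection` (`prinSection hR1 G`: the metaplectic element over `toSp G` whose `det^{1/2}`-value is the
principal root `prinRoot G = (det G)^{1/2}`; `prinSectionV/W` over `ι_V`, `ι_W`;
**`detCoverLifting_of_continuousAt_prinSection`**: the record `(Mp₂.coverDatum P Q R S h1 h2).DetCoverLifting` at every
real rank from the SINGLE remaining input `ContinuousAt (prinSectionV h1) 1 ∧ ContinuousAt (prinSectionW h1) 1`).

THIS FILE REDUCES THAT INPUT TO THE STRONG CONTINUITY OF ONE HOMOMORPHISM and records the exact comparison.  The
tree holds, at every signature and real rank, the `det^{1/2}`-normalised HOMOMORPHISM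
`UnitaryWeil.weilHomV : U(P,Q) →* Mp^𝓢(𝕎)` over `ι_V` (`Weil1964.ArchMetaplecticUnitarySplitting`:
`C(weilHomV g) = (det d(g ⊗ 1))⁻¹`, continuous in `g`); its strong continuity (w1) — `g ↦ weilHomV g f` continuous for
every Schwartz `f`, i.e. `Continuous weilHomV` for the strong operator topology of `ArchMetaplecticStrongTopology` — is
the `KAK` statement of the sequel `Weil1964.ArchMetaplecticUnitarySplittingContinuity` (stage-1 seat own-s1arch) and
enters HERE AS THE DISPLAYED HYPOTHESIS `hV : Continuous (weilHomV P Q R S)` (resp. `hW` for the swapped pair); the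
hypothesis-free corollaries are the two-line sequel `DetCoverLiftingGeneralRankHolds`.  Schur's remark read at the
vacuum (`Weil1964.ArchMetaplecticSchurContinuity`) compares the two sections over `ι_V`:

* §1 `C(prinSection G) = √(det G) / det d(G)` (`vac_prinSection`), continuous at every `G` with `det G` off the
  branch cut (`continuousAt_vac_prinSection`), in particular at `1`; the EXACT formula
  **`prinSection G = √(det G) · weilElt G`** on Schwartz functions (`prinSection_apply_eq_prinRoot_smul`), `‖√det G‖ = 1`;
* §2 given `hV`: **`continuousAt_prinSectionV_of_continuous`** (at every `g` with `det(g ⊗ 1)` off the cut) and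
  **`continuousAt_prinSectionV_one_of_continuous`**; conversely `prinSectionV` continuous at `1` forces `weilHomV`
  continuous at `1` (`continuousAt_weilHomV_one_of_prinSectionV`) — the two continuity statements are EQUIVALENT there;
* §3 the `W`-side by the `V ↔ W` symmetry: `h ↦ reindex (swapIdx R S P Q)⁻¹ (weilHomV_{RSPQ} h)` is a homomorphic
  section over `ι_W` (`ιW_eq_reindexSp_ιV_swap`), continuous if `weilHomV_{RSPQ}` is (`MpS.continuous_reindex`), hence
  **`continuousAt_prinSectionW_one_of_continuous`**;
* §4 **`detCoverLifting_of_continuous_weilHomV`**: `(Mp₂.coverDatum P Q R S h1 h2).DetCoverLifting` for ALL `P, Q, R, S`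
  (both members non-trivial) from R1, R2 and the strong continuity of `weilHomV_{PQRS}` and `weilHomV_{RSPQ}`; and
  **`detCoverLifting_of_continuous_weilHomV_holds`** with R1 = `folland1989_Thm_4_37_ab_holds`,
  R2 = `folland1989_Thm_4_37_c_holds` — Paul's (1.2.1)–(1.2.2) «`Ũ(p,q)` is isomorphic to the `det^{(r−s)/2}`-cover,
  `Ũ(r,s)` to the `det^{(p−q)/2}`-cover, and they commute in `S̃p`», as the tree's record `DetCoverLifting`, at every
  real rank, modulo (w1) of `weilHomV` ONLY.  (The rank-one / compact cases of `MetaplecticDetCoverLifting` §5–§6 are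
  hypothesis-free instances already.)

## References

* [Paul1998] A. Paul, *Howe correspondence for real unitary groups*, J. Funct. Anal. 159 (1998) 384–431, §1.2
  (1.2.1)–(1.2.2) p. 389 L11–31.
* [Folland1989] G. B. Folland, *Harmonic Analysis in Phase Space*, Princeton UP 1989, §4.2 p. 156 L18–30, (4.36),
  Thm. (4.37), Prop. (4.39).
* [Kudla1994] S. S. Kudla, *Splitting metaplectic covers of dual reductive pairs*, Israel J. Math. 87 (1994), §5.
* [Adams2007] J. Adams, *The theta correspondence over ℝ*, in: Harmonic analysis, group representations, automorphic
  forms and invariant theory, World Scientific 2007, §3, Rem. 5.1.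
-/

set_option autoImplicit false

noncomputable section

open Matrix Complex MeasureTheory SchwartzMap Filter
open scoped ComplexConjugate Topology

namespace Literature.RepresentationTheory.Paul1998

namespace MetaplecticSplitting

open Literature.RepresentationTheory.KonnoKonno2007 Literature.RepresentationTheory.KonnoKonno2007.RealDualPair
open Literature.NumberTheory.Weil1964 Literature.NumberTheory.Weil1964.MpS Literature.NumberTheory.Weil1964.UnitaryBall
open Literature.NumberTheory.Weil1964.UnitaryWeil
open Literature.NumberTheory.Automorphic Literature.NumberTheory.Automorphic.UnitaryGroup
open Literature.Analysis.SegalBargmann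

/-! ## 1. The vacuum coefficient of the principal section and the exact comparison with `weilElt` -/

section Principal

variable {α β : Type*} [Fintype α] [DecidableEq α] [Fintype β] [DecidableEq β]

/-- **`C(τ(G)) = √(det G) / det d(G)`**: the vacuum coefficient of the principal section (`θ = C · det d`,
`θ(τ(G)) = √(det G)`). [cite: Paul1998, §1.2 (1.2.2); Folland1989, §4.2 (4.36)] -/
theorem vac_prinSection (hR1 : Folland1989_Thm_4_37_ab (α ⊕ β)) (G : UForm α β) :
    vac (prinSection hR1 G) = prinRoot G / (d G).det := by
  rw [eq_div_iff (det_d_ne_zero G)]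
  exact detHalf_prinSection hR1 G

/-- `G ↦ det d(G)` is continuous on `U(α, β)`. [folklore] -/
private theorem continuous_det_d : Continuous fun G : UForm α β => (d G).det := by
  have hd : Continuous fun G : UForm α β => d G := by
    show Continuous fun G : UForm α β => (mat G).submatrix Sum.inr Sum.inr
    exact (Units.continuous_val.comp continuous_subtype_val).matrix_submatrix _ _
  exact hd.matrix_det

/-- `G ↦ det G` is continuous on `U(α, β)`. [folklore] -/
private theorem continuous_det_mat' : Continuous fun G : UForm α β => (mat G).det :=
  (Units.continuous_val.comp continuous_subtype_val).matrix_det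

/-- **`√(det G)` is continuous at every `G` whose determinant lies off the branch cut** `(−∞, 0]`.
[cite: Paul1998, §1.2 (1.2.2)] -/
theorem continuousAt_prinRoot {G₀ : UForm α β} (hG : (mat G₀).det ∈ Complex.slitPlane) :
    ContinuousAt (prinRoot : UForm α β → ℂ) G₀ :=
  (continuousAt_cpow_const (b := (2 : ℂ)⁻¹) hG).comp (f := fun G : UForm α β => (mat G).det)
    continuous_det_mat'.continuousAt

/-- `det 1 = 1` lies off the cut. [folklore] -/
private theorem det_mat_one_mem_slitPlane : (mat (1 : UForm α β)).det ∈ Complex.slitPlane := by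
  rw [mat_one, Matrix.det_one]
  exact Complex.one_mem_slitPlane

/-- **`C(τ(G))` is continuous at every `G` off the branch cut.** [cite: Paul1998, §1.2 (1.2.2); Folland1989, §4.2 (4.36)] -/
theorem continuousAt_vac_prinSection (hR1 : Folland1989_Thm_4_37_ab (α ⊕ β)) {G₀ : UForm α β}
    (hG : (mat G₀).det ∈ Complex.slitPlane) : ContinuousAt (fun G => vac (prinSection hR1 G)) G₀ := by
  simp only [vac_prinSection]
  exact (continuousAt_prinRoot hG).div continuous_det_d.continuousAt (det_d_ne_zero G₀)

/-- … in particular at `G = 1`. [cite: Paul1998, §1.2 (1.2.2)] -/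
theorem continuousAt_vac_prinSection_one (hR1 : Folland1989_Thm_4_37_ab (α ⊕ β)) :
    ContinuousAt (fun G => vac (prinSection hR1 G)) 1 :=
  continuousAt_vac_prinSection hR1 det_mat_one_mem_slitPlane

/-- **The principal section IS `√det` times the `det^{1/2}`-normalised Weil element**:
`τ(G) f = √(det G) · weilElt G f` for every Schwartz `f` (both lie over `toSp G`; `C(weilElt G) = (det d(G))⁻¹`).
[cite: Paul1998, §1.2 (1.2.1)–(1.2.2); Kudla1994, §5; Folland1989, §4.2 p. 156 L18–30] -/
theorem prinSection_apply_eq_prinRoot_smul (hR1 : Folland1989_Thm_4_37_ab (α ⊕ β)) (G : UForm α β)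
    (f : SchwartzMap ((α ⊕ β) → ℝ) ℂ) :
    (prinSection hR1 G).1.2 f = prinRoot G • (weilElt G).1.2 f := by
  have hp : proj (weilElt G) = proj (prinSection hR1 G) := by rw [proj_weilElt, proj_prinSection]
  rw [MpS.apply_eq_vac_div_vac_smul hp f, vac_prinSection, vac_weilElt, div_inv_eq_mul,
    div_mul_cancel₀ _ (det_d_ne_zero G)]

/-- `‖√(det G)‖ = 1` on `U(α, β)` (`|det G| = 1`). [cite: Paul1998, §1.2 (1.2.2)] -/
theorem norm_prinRoot (G : UForm α β) : ‖prinRoot G‖ = 1 := by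
  have h : ‖prinRoot G‖ ^ 2 = 1 := by rw [← norm_pow, prinRoot_sq, norm_det_mat]
  exact (pow_eq_one_iff_of_nonneg (norm_nonneg _) two_ne_zero).1 h

end Principal

/-! ## 2. The `V`-side: `prinSectionV` is strongly continuous at every `g` off the cut, in particular at `1` -/

section VSide

variable {P Q R S : Type*} [Fintype P] [DecidableEq P] [Fintype Q] [DecidableEq Q] [Fintype R] [DecidableEq R]
  [Fintype S] [DecidableEq S]

/-- **(w1) ⇒ strong continuity INTO `Mp^𝓢(𝕎)`**: if every orbit map `g ↦ weilHomV g f` is continuous into `𝓢`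
then `weilHomV : U(P,Q) → Mp^𝓢(𝕎)` is continuous for the strong operator topology (a fortiori: `𝓢 → L²` is
continuous). [cite: Folland1989, §4.2 p. 156 L24; Kudla1994, §5] -/
theorem continuous_weilHomV_of_apply
    (h : ∀ f : SchwartzMap (DPIdx P Q R S → ℝ) ℂ, Continuous fun g : UForm P Q => (weilHomV P Q R S g).1.2 f) :
    Continuous (weilHomV P Q R S : UForm P Q → MpS (DPIdx P Q R S)) :=
  MpS.continuous_iff.2 fun f => toL2.continuous.comp (h f)

/-- **Continuity of the homomorphism `weilHomV` at `1` is continuity everywhere** (`Mp^𝓢(𝕎)` is a topological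
group). [cite: Folland1989, §4.2 p. 156 L24; Kudla1994, §5] -/
theorem continuous_weilHomV_of_continuousAt_one
    (h : ContinuousAt (weilHomV P Q R S : UForm P Q → MpS (DPIdx P Q R S)) 1) :
    Continuous (weilHomV P Q R S : UForm P Q → MpS (DPIdx P Q R S)) :=
  continuous_of_continuousAt_one (weilHomV P Q R S) h

/-- `prinSectionV` and `weilHomV` lie over the same symplectic maps `ι_V g = ι𝕎 (g, 1)`. [cite: Paul1998, §1.2 (1.2.1)] -/
theorem proj_prinSectionV_eq_proj_weilHomV (hR1 : Folland1989_Thm_4_37_ab (DPIdx P Q R S)) (g : UForm P Q) :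
    proj (prinSectionV (P := P) (Q := Q) (R := R) (S := S) hR1 g) = proj (weilHomV P Q R S g) := by
  rw [proj_weilHomV]
  exact proj_prinSection hR1 _

/-- `g ↦ g ⊗ 1_W` is continuous. [cite: KonnoKonno2007, §3.1 (3.1)] -/
theorem continuous_toBig_inl : Continuous fun g : UForm P Q => toBig P Q R S (g, 1) :=
  continuous_toBig.comp (continuous_id.prodMk continuous_const)

/-- **`prinSectionV` is strongly continuous at every `g` with `det(g ⊗ 1_W)` off the branch cut.**
[cite: Paul1998, §1.2 (1.2.1)–(1.2.2) p. 389 L11–31; Folland1989, §4.2 p. 156 L18–30] -/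
theorem continuousAt_prinSectionV_of_continuous (hR1 : Folland1989_Thm_4_37_ab (DPIdx P Q R S))
    (hV : Continuous (weilHomV P Q R S : UForm P Q → MpS (DPIdx P Q R S))) {g₀ : UForm P Q}
    (hg : (mat (toBig P Q R S (g₀, 1))).det ∈ Complex.slitPlane) :
    ContinuousAt (prinSectionV (P := P) (Q := Q) (R := R) (S := S) hR1) g₀ := by
  refine MpS.continuousAt_of_proj_eq (proj_prinSectionV_eq_proj_weilHomV hR1) hV.continuousAt ?_
  show ContinuousAt (fun g : UForm P Q => vac (prinSection hR1 (toBig P Q R S (g, 1)))) g₀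
  exact (continuousAt_vac_prinSection hR1 hg).comp (f := fun g : UForm P Q => toBig P Q R S (g, 1))
    continuous_toBig_inl.continuousAt

/-- **`prinSectionV` is strongly continuous at `1`** — the `V`-half of the last input of
`detCoverLifting_of_continuousAt_prinSection`, at every real rank. [cite: Paul1998, §1.2 (1.2.1)–(1.2.2) p. 389 L11–31] -/
theorem continuousAt_prinSectionV_one_of_continuous (hR1 : Folland1989_Thm_4_37_ab (DPIdx P Q R S))
    (hV : Continuous (weilHomV P Q R S : UForm P Q → MpS (DPIdx P Q R S))) :
    ContinuousAt (prinSectionV (P := P) (Q := Q) (R := R) (S := S) hR1) 1 := by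
  refine continuousAt_prinSectionV_of_continuous hR1 hV ?_
  rw [show ((1 : UForm P Q), (1 : UForm R S)) = (1 : Ginf P Q R S) from rfl, map_one]
  exact det_mat_one_mem_slitPlane

/-- **Conversely**: `weilHomV` is continuous at `1` as soon as the principal section `prinSectionV` is (the two differ
by the scalar `√det(g ⊗ 1)`, continuous at `1`) — so, `weilHomV` being a homomorphism into a topological group, the
two continuity statements at `1` are EQUIVALENT and each gives continuity of `weilHomV` everywhere.
[cite: Folland1989, §4.2 p. 156 L18–30; Kudla1994, §5] -/
theorem continuous_weilHomV_of_continuousAt_prinSectionV_one (hR1 : Folland1989_Thm_4_37_ab (DPIdx P Q R S))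
    (h : ContinuousAt (prinSectionV (P := P) (Q := Q) (R := R) (S := S) hR1) 1) :
    Continuous (weilHomV P Q R S : UForm P Q → MpS (DPIdx P Q R S)) := by
  refine continuous_weilHomV_of_continuousAt_one (MpS.continuousAt_of_proj_eq
    (fun g => (proj_prinSectionV_eq_proj_weilHomV hR1 g).symm) h ?_)
  exact (continuous_vac_weilHomV (P := P) (Q := Q) (R := R) (S := S)).continuousAt

/-- the EXACT `V`-side formula: `τ_V(g) f = √det(g ⊗ 1) · weilHomV g f`. [cite: Paul1998, §1.2 (1.2.1)–(1.2.2); Kudla1994, §5] -/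
theorem prinSectionV_apply_eq (hR1 : Folland1989_Thm_4_37_ab (DPIdx P Q R S)) (g : UForm P Q)
    (f : SchwartzMap (DPIdx P Q R S → ℝ) ℂ) :
    (prinSectionV (P := P) (Q := Q) (R := R) (S := S) hR1 g).1.2 f =
      prinRoot (toBig P Q R S (g, 1)) • (weilHomV P Q R S g).1.2 f :=
  prinSection_apply_eq_prinRoot_smul hR1 _ f

end VSide

/-! ## 3. The `W`-side by the `V ↔ W` symmetry -/

section WSide

variable {P Q R S : Type*} [Fintype P] [DecidableEq P] [Fintype Q] [DecidableEq Q] [Fintype R] [DecidableEq R]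
  [Fintype S] [DecidableEq S]

/-- **A continuous homomorphic section over `ι_W`**: the `V`-side Weil homomorphism of the SWAPPED pair
`(U(R,S), U(P,Q))`, relabelled along `swapIdx`, lies over `ι_W h = ι𝕎 (1, h)`. [cite: KonnoKonno2007, §3.1 (3.1); Kudla1994, §5] -/
theorem proj_reindex_weilHomV_swap (h : UForm R S) :
    proj (MpS.reindex (swapIdx R S P Q).symm (weilHomV R S P Q h)) = ι𝕎 P Q R S (1, h) := by
  rw [proj_reindex, proj_weilHomV, ιW_eq_reindexSp_ιV_swap]

/-- … and it is continuous into `Mp^𝓢(𝕎)` as soon as `weilHomV_{RSPQ}` is. [cite: Folland1989, §4.2 p. 156 L24; Weil1964, Chap. I n° 12] -/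
theorem continuous_reindex_weilHomV_swap
    (hW : Continuous (weilHomV R S P Q : UForm R S → MpS (DPIdx R S P Q))) :
    Continuous fun h : UForm R S => MpS.reindex (swapIdx R S P Q).symm (weilHomV R S P Q h) :=
  (MpS.continuous_reindex _).comp hW

/-- `h ↦ 1_V ⊗ h` is continuous. [cite: KonnoKonno2007, §3.1 (3.1)] -/
theorem continuous_toBig_inr : Continuous fun h : UForm R S => toBig P Q R S (1, h) :=
  continuous_toBig.comp (continuous_const.prodMk continuous_id)

/-- **`prinSectionW` is strongly continuous at every `h` with `det(1_V ⊗ h)` off the branch cut.**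
[cite: Paul1998, §1.2 (1.2.1) p. 389 L23; Folland1989, §4.2 p. 156 L18–30] -/
theorem continuousAt_prinSectionW_of_continuous (hR1 : Folland1989_Thm_4_37_ab (DPIdx P Q R S))
    (hW : Continuous (weilHomV R S P Q : UForm R S → MpS (DPIdx R S P Q))) {h₀ : UForm R S}
    (hh : (mat (toBig P Q R S (1, h₀))).det ∈ Complex.slitPlane) :
    ContinuousAt (prinSectionW (P := P) (Q := Q) (R := R) (S := S) hR1) h₀ := by
  refine MpS.continuousAt_of_proj_eq (Y := fun h : UForm R S => MpS.reindex (swapIdx R S P Q).symm (weilHomV R S P Q h))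
    (fun h => ?_) (continuous_reindex_weilHomV_swap hW).continuousAt ?_
  · rw [proj_reindex_weilHomV_swap]
    exact proj_prinSection hR1 _
  · show ContinuousAt (fun h : UForm R S => vac (prinSection hR1 (toBig P Q R S (1, h)))) h₀
    exact (continuousAt_vac_prinSection hR1 hh).comp (f := fun h : UForm R S => toBig P Q R S (1, h))
      continuous_toBig_inr.continuousAt

/-- **`prinSectionW` is strongly continuous at `1`** — the `W`-half of the last input, at every real rank.
[cite: Paul1998, §1.2 (1.2.1) p. 389 L23] -/
theorem continuousAt_prinSectionW_one_of_continuous (hR1 : Folland1989_Thm_4_37_ab (DPIdx P Q R S))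
    (hW : Continuous (weilHomV R S P Q : UForm R S → MpS (DPIdx R S P Q))) :
    ContinuousAt (prinSectionW (P := P) (Q := Q) (R := R) (S := S) hR1) 1 := by
  refine continuousAt_prinSectionW_of_continuous hR1 hW ?_
  rw [show ((1 : UForm P Q), (1 : UForm R S)) = (1 : Ginf P Q R S) from rfl, map_one]
  exact det_mat_one_mem_slitPlane

end WSide

/-! ## 4. The record `DetCoverLifting` for `Mp₂(𝕎)` at every real rank, modulo (w1) of `weilHomV` only -/

section Record

variable {P Q R S : Type*} [Fintype P] [DecidableEq P] [Fintype Q] [DecidableEq Q] [Fintype R] [DecidableEq R]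
  [Fintype S] [DecidableEq S] [Nonempty (P ⊕ Q)] [Nonempty (R ⊕ S)]

/-- **PAUL'S (1.2.1)–(1.2.2) FOR `S̃p = Mp₂(𝕎)` AT EVERY REAL RANK, FROM R1, R2 AND THE STRONG CONTINUITY OF THE
WEIL HOMOMORPHISMS OF THE TWO MEMBERS**: the preimages of `ι_V U(P,Q)` and `ι_W U(R,S)` in the metaplectic double
cover are the `det^{(|R|−|S|)/2}`- and `det^{(|P|−|Q|)/2}`-covers, commuting, and the product map is a CONTINUOUS
homomorphism — the tree's record `DualPairCoverDatum.DetCoverLifting` for `Mp₂.coverDatum P Q R S h1 h2`, for ALL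
finite `P, Q, R, S` with both members non-trivial. [cite: Paul1998, §1.2 (1.2.1)–(1.2.2) p. 389 L11–31; Adams2007, §3, Rem. 5.1] -/
theorem detCoverLifting_of_continuous_weilHomV (h1 : Folland1989_Thm_4_37_ab (DPIdx P Q R S))
    (h2 : Folland1989_Thm_4_37_c (DPIdx P Q R S))
    (hV : Continuous (weilHomV P Q R S : UForm P Q → MpS (DPIdx P Q R S)))
    (hW : Continuous (weilHomV R S P Q : UForm R S → MpS (DPIdx R S P Q))) :
    (Mp₂.coverDatum P Q R S h1 h2).DetCoverLifting :=
  detCoverLifting_of_continuousAt_prinSection h1 h2 (continuousAt_prinSectionV_one_of_continuous h1 hV)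
    (continuousAt_prinSectionW_one_of_continuous h1 hW)

/-- **… with R1 and R2 discharged** (`folland1989_Thm_4_37_ab_holds`, `folland1989_Thm_4_37_c_holds`, Folland's
Theorem (4.37) proved in `ArchMetaplecticDoubleCoverHolds`): the record `(Mp₂.coverDatum P Q R S R1 R2).DetCoverLifting`
at every signature `(|P|,|Q|;|R|,|S|)` follows from the strong continuity of `weilHomV_{PQRS}` and `weilHomV_{RSPQ}` ALONE.
[cite: Paul1998, §1.2 (1.2.1)–(1.2.2) p. 389 L11–31; Folland1989, §4.2 Thm. (4.37); Adams2007, §3] -/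
theorem detCoverLifting_of_continuous_weilHomV_holds
    (hV : Continuous (weilHomV P Q R S : UForm P Q → MpS (DPIdx P Q R S)))
    (hW : Continuous (weilHomV R S P Q : UForm R S → MpS (DPIdx R S P Q))) :
    (Mp₂.coverDatum P Q R S (folland1989_Thm_4_37_ab_holds (DPIdx P Q R S))
      (folland1989_Thm_4_37_c_holds (DPIdx P Q R S))).DetCoverLifting :=
  detCoverLifting_of_continuous_weilHomV _ _ hV hW

/-- the same from the ORBIT form of (w1) (the currency of `IsArchWeilDatum.continuous_apply`): every
`g ↦ weilHomV g f` continuous into `𝓢`, for both members. [cite: Paul1998, §1.2 (1.2.1)–(1.2.2) p. 389 L11–31] -/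
theorem detCoverLifting_of_continuous_weilHomV_apply_holds
    (hV : ∀ f : SchwartzMap (DPIdx P Q R S → ℝ) ℂ, Continuous fun g : UForm P Q => (weilHomV P Q R S g).1.2 f)
    (hW : ∀ f : SchwartzMap (DPIdx R S P Q → ℝ) ℂ, Continuous fun h : UForm R S => (weilHomV R S P Q h).1.2 f) :
    (Mp₂.coverDatum P Q R S (folland1989_Thm_4_37_ab_holds (DPIdx P Q R S))
      (folland1989_Thm_4_37_c_holds (DPIdx P Q R S))).DetCoverLifting :=
  detCoverLifting_of_continuous_weilHomV_holds (continuous_weilHomV_of_apply hV) (continuous_weilHomV_of_apply hW)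

end Record

end MetaplecticSplitting

end Literature.RepresentationTheory.Paul1998
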